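import Literature.MathematicalPhysics.QuantumFieldTheory.Balaban1983to89.B16NodeKnitRecord9
import Literature.MathematicalPhysics.QuantumFieldTheory.Balaban1983to89.B16Cor3CurlyGas

/-!
# `Balaban1983to89.B16NodeKnitRecord9Cor3` — YM-DAG node N13 · [Balaban1989LargeFieldII] CMP **122** (1989) 355–392, (0.1) pp. 355–356 ∕ Cor. 3 [III]
# (2.50) p. 264, p. 387: THE ₉ JUNCTION OF THE CELL'S COR.-3 CHAIN TO THE DENSITIES OF RECORD — the chain's one-run-one-step END theorem
# `B16Cor3CurlyGas.uvIneq_of_repr172_torus_of_ineq249_of_gas` READ AT NODE 00's Stage-9 objects (`densOfRecord₉`, `chiOfRecord`, `wilsonBGOfRecord`,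
# `gOfRecord₉`, `|T₁^{(k)}|`), and N13 at a Stage-9 world from (R₉) + the chain's object-level leaves + domination of its explicit `E₋, E₊`

statement-level bookkeeping over published theorems with citation tags; kernel-checked compositions of tree theorems;
nothing here is a claim about the Yang–Mills mass gap.

CITATION HEADER (lean-in-tree rule).  Sources: T. Bałaban, *Large field renormalization. II. Localization, exponentiation, and bounds for the 𝐑 operation*,
Commun. Math. Phys. **122**, 355–392 (1989), doi:10.1007/bf01238433 [Balaban1989LargeFieldII] («[V]»: Thm 1 p. 355, (0.1) pp. 355–356, (1.72) p. 379, (1.79) p. 383,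
(1.89)–(1.90) p. 387, (1.97)–(1.98) p. 390, p. 391), with T. Bałaban, *Convergent renormalization expansions for lattice gauge theories*, Commun. Math. Phys. **119**,
243–285 (1988) [Balaban1988Convergent] («[III]»: (2.17)–(2.18) p. 257, Thm 2 (2.49) p. 264, Cor. 3 (2.50) p. 264).  WHAT IS PRINTED: [V] p. 387 *"Next, we have noticed
already that the inequality (1.79) holds for the 𝐓-operation connected with an arbitrary large field region. The inequality (1.80) holds quite generally for such regions,
hence also an improved bound (1.89), with the additional term −κ₁d_k(X) in the exponential. This implies the inequality (2.50) [III], hence Corollary 3."*; [III] p. 264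
*"χ_k exp[−(1/g_k²)A(U_k(V_k)) − E₋|T_η|] ≦ ρ_k(V_k) ≦ exp E₊|T_η|. (2.50)"*.  Seat `pub-ymgap-dag-n13-a` (YM-PLAN Track A, HUMAN RULING D-0062), module 15 of the seat;
the object of ref-B READ-266's clause «the ₉ junction to `densOfRecord₉` still to be written».  BY NAME and UNCHANGED: `…B16Cor3CurlyGas.uvIneq_of_repr172_torus_of_ineq249_of_gas`
(seat dag-n14-b, p410245; with `…B16Cor3ActionBounds` dag-n21-b p409433 and `…B16CurlyBracketVolume` dag-n14-b p409558 inside it), `…B16NodeKnitRecord9` (module 14: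
`b16_main_at_record₉_dominated`), `…Node00.Record9` (seat node00-def-T: `Stage9Params`, `.Provisos`, `datumOfRecord₉`, `datumOfRecord₉_C`, `coreOfRecord₉`, `densOfRecord₉`,
`gOfRecord₉`, `betaOfRecord₉`, `SLaw₉`, `TLaw₉`, `upOfRecord₅C`), `…Node00.BackgroundActionOfRecord` (`wilsonBGOfRecord`, `wilsonBGOfRecord_nonneg`), `…Node00.SmallFieldChiOfRecord`
(`chiOfRecord`), `…T4DatumAssembly` (`RGMachineCore.construction`, T4DatumAssemblyTower :141), `…B16` (`UVIneq` :180), `…Dag` (`B16_main` :253).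

WHY THIS FILE.  The Cor.-3 chain of the surge-node lineage (`B14Cor3` → … → `B16Cor3CurlyGas`) proves (2.50) [III] ∕ (0.1) for ONE run and ONE step from a (1.72) representation
of `ρ_k` on the torus cube catalogue, at an ABSTRACT run datum `D : B16.RunData` — conclusion `∀ V, B16.UVIneq D k V E₋ E₊` with explicit `E₋, E₊`.  Module 14 §3's socket
`b16_main_at_record₉_dominated` takes exactly that currency at `D := (datumOfRecord₉ F N θ h).C P`.  At that `D` EVERY `D`-face the chain reads is an object of record BY `rfl`
(`datumOfRecord₉_C`: `(datumOfRecord₉ F N θ h).C = (coreOfRecord₉ F N θ).construction (densOfRecord₉ F N θ)`; `RGMachineCore.construction`): `D.Cfg k = GaugeField (F.P P.K) k (SU N)`,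
`D.ρ k = densOfRecord₉ F N θ P k` (`= eval rep_k`, EXPLICIT), `D.χ k = chiOfRecord F N θ.ν (gOfRecord₉ F N θ P) P.K k`, `D.wilsonBG k = wilsonBGOfRecord F N θ.εbg P k`,
`D.flow.g k = gOfRecord₉ F N θ P k`, `D.numSites k = Fintype.card (Site (F.P P.K) k)`.  So the chain's END theorem can be READ AT THE RECORD (§1), with one of its binders
DISCHARGED there — `hA0 : 0 ≤ A_k(V)` is the THEOREM `Node00.wilsonBGOfRecord_nonneg` —, and composed with module 14 §3 into ONE statement of N13 at a Stage-9 world whose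
remaining binders are (R₉) and the chain's object-level leaves READ AT `densOfRecord₉` (§2).  §0 is the same reading at ANY machine core's construction over ANY density family
(serves module 12's tower-datum worlds, `(datumOfTower F N M τ).C = M.construction τ.ρ`, alike).

WHAT THIS FILE PROVES (0 `sorry`, 0 `def`, standard axioms).
§0 `uvIneq_at_construction_iff` ((0.1) at `M.construction ρ P` unfolded, `Iff.rfl`); **`uvIneq_at_construction_of_gas`** (the chain's END theorem at `D := M.construction ρ P`:
   `ρ_k := ρ P k`, `χ_k := M.χ P k`, `A := M.wilsonBG P k`, `g_k := genSeq M.βfun P.g0 k`, `|T_η| := |Site (F.P P.K) k|`; `hA0` kept as the core's sign hypothesis).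
§1 `uvIneq_at_record₉_iff` (the same reading at `D := (datumOfRecord₉ F N θ h).C P`: (0.1) POINTWISE on `densOfRecord₉ F N θ P k`); **`uvIneq_at_record₉_of_gas`** (the chain's
   END theorem AT THE OBJECTS OF RECORD, `hA0` DISCHARGED by `wilsonBGOfRecord_nonneg`).
§2 **`b16_main_at_record₉_of_chainLetters`** — N13 (`Dag.B16_main (leavesP w P)`) at a Stage-9 world (`w.C = (datumOfRecord₉ F N θ h).C`, `w.up P = upOfRecord₅C F N (θ.toStage5 F N) P`)
   from (R₉) law transport and, for every §2-format level `k ≤ K` below the threshold, (0.1) IN THE CHAIN'S OWN LETTERS (level-indexed constant families; = §1's conclusion level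
   by level) with DOMINATION of the explicit `E₋(k), E₊(k)` by the world's dependence functions `w.em (g_k)`, `w.ep (g_k)` (p. 356 «E₋, E₊ independent of k, T_η, U_k»);
   = module 14 §3 with `Em := E₋(k)`, `Ep := E₊(k)`; **`b16_main_of_isRecordOfRecord₉C_of_chainLetters`** (the same from `IsRecordOfRecord₉C F N D w`, the `S_N13 (₉C)`-currency form,
   families indexed by `θ, P, k`).

WHAT REMAINS A BINDER (located; nothing on pp. 383–391 derives them): `hH : R.Holds (densOfRecord₉ F N θ P k)` — (1.72) HOLDS FOR `ρ_k` OF RECORD ([V] Thm 1's own «𝐑ρ_k can be written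
in the form …», p. 390; over ₉⁺ = ₉C + `Node00/Sect2FormOfRecord` per RIDER №38 — at Stage 9 `densOfRecord₉` is `eval` of a (2.18) representation `reprOfRecord₉`, and a (1.72)
representation of it on the torus catalogue is NOT an object of the tree; def-R's v3 `Node00/ROperationOfRecord172` types (1.72) data over `Set (Site (F.P p.K) 0)`, not over `(tsys 4 Nc).Dom`);
the χ-dictionary `h0χ`; the factor leaves `hZ ∕ hY` ((1.79) ∕ (1.89)-improved per component); the (1.90)-gas leaves at the genuine operations; (2.49) [III] `h249` (= N11's Thm 2 output
— the N11 → N13 Cor.-3 edge AT THE RECORD) with the volume majorant and the log-term bounds; the torus site count `hnum`; and (R₉).  HONEST FRAMING: a count-neutral SLOT junction BY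
NAME (R429 (4)(i)); N13 is NOT discharged; nothing of Bałaban's asserted or proved here; one finite four-torus programme at fixed `ε`, Bałaban AS PRINTED with locators; nothing
continuum ∕ ℝ⁴ ∕ OS ∕ mass gap ∕ Clay.
-/

noncomputable section

open MeasureTheory
open scoped BigOperators

namespace Literature.MathematicalPhysics.QuantumFieldTheory.Balaban1983to89.B16NodeKnitRecord9Cor3

open DagBinding T4DatumAssembly T4Continuum Node00 FlowStepRuns
open B14Thm2 (Ineq249)
open B16Cor3Ops (Repr172)
open TreeLengthTorus (tsys)
open B13FamilySum (Ineq126 VolBound)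
open B16Eq190Resummation (bracket mayerTerm F191 polys190 LocalOps DepOn)
open B16Cor3CurlyGas (uvIneq_of_repr172_torus_of_ineq249_of_gas)
open B16NodeKnitRecord9 (b16_main_at_record₉_dominated)

variable (F : T4Family) (N : ℕ) [NeZero N]

/-! ## §0. The chain's END theorem at a machine core's construction over ANY density family -/

section Construction

variable (M : RGMachineCore F (SU N)) (ρ : (p : B12.RunParams) → (k : ℕ) → Density (F.P p.K) k (SU N)) (P : B12.RunParams) (k : ℕ)

/-- **(0.1) ∕ (2.50) AT A CONSTRUCTION, unfolded** (`rfl` through `RGMachineCore.construction`): at `D := M.construction ρ P`, `B16.UVIneq D k V Em Ep` IS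
«`χ_k(V)·exp[−(1∕g_k²)A_k(V) − Em·|T₁^{(k)}|] ≤ ρ_k(V)` ∧ `ρ_k(V) ≤ exp(Ep·|T₁^{(k)}|)`» with `χ_k = M.χ P k`, `A_k = M.wilsonBG P k`, `g_k = genSeq M.βfun P.g0 k`, `ρ_k = ρ P k`,
`|T₁^{(k)}| = |Site (F.P P.K) k|`. [cite: Balaban1989LargeFieldII, (0.1) pp.355–356; Balaban1988Convergent, (2.50) p.264 (bookkeeping)] -/
theorem uvIneq_at_construction_iff (V : GaugeField (F.P P.K) k (SU N)) (Em Ep : ℝ) :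
    B16.UVIneq (M.construction ρ P) k V Em Ep ↔
      M.χ P k V * Real.exp (-(1 / (genSeq M.βfun P.g0 k) ^ 2 * M.wilsonBG P k V) - Em * (Fintype.card (Site (F.P P.K) k) : ℝ)) ≤ ρ P k V ∧
        ρ P k V ≤ Real.exp (Ep * (Fintype.card (Site (F.P P.K) k) : ℝ)) :=
  Iff.rfl

/-- **THE COR.-3 CHAIN'S END THEOREM AT A CONSTRUCTION** (`B16Cor3CurlyGas.uvIneq_of_repr172_torus_of_ineq249_of_gas` at `D := M.construction ρ P`, by `rfl` on every `D`-face):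
from a (1.72) representation `R` of `ρ P k` on the torus cube catalogue `tsys 4 Nc` (`hH`), its χ-dictionary against the core's `χ_k` (`hχ01`, `h0χ`), the site count `|T₁^{(k)}| = (M₁·Nc)⁴`,
the factor leaves (1.79)∕(1.89) per component (`hZ`, `hY`), the (1.90) gas of every admissible term (locality ∕ reality ∕ (1.97)-shaped activity ∕ relative leaves ∕ Kotecký–Preiss
constants ∕ the junction `curly = Re{⋯}`), the cube count, (2.49) [III] for `A′` against `(1∕g_k²)·A_k` with the volume majorant and the log-term bounds, and the core's sign
`0 ≤ A_k` (`hA0`): (0.1) at every configuration with the chain's explicit constants.  CONDITIONAL on every input; nothing of Bałaban's asserted.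
[cite: Balaban1989LargeFieldII, (0.1) p.356 and p.387 after (1.89); Balaban1988Convergent, (2.49)–(2.50) p.264] -/
theorem uvIneq_at_construction_of_gas (Nc : ℕ) [NeZero Nc] (R : Repr172 (GaugeField (F.P P.K) k (SU N)) (tsys 4 Nc).Dom)
    {M₁ : ℝ} (hM : M₁ ≠ 0) (hnum : (Fintype.card (Site (F.P P.K) k) : ℝ) = (M₁ * Nc) ^ 4)
    {κ₁ : ℝ} (hκ : B12TreeDecay.kappa₀ (4 * 2 ^ 4) (2 * 4) ≤ κ₁) (c : Fin 2 → ℝ)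
    (hH : R.Holds (ρ P k))
    (hχ01 : ∀ a V, 0 ≤ R.χ a V ∧ R.χ a V ≤ 1)
    (h0χ : ∀ V, R.χ R.allSmall V = M.χ P k V)
    (hZ : ∀ a V, (R.TZ a).T 1 V ≤ ∏ X ∈ R.Zc a, Real.exp (-(c 0) - κ₁ * (tsys 4 Nc).dj X))
    (hY : ∀ a V, (R.TYs a).T 1 V ≤ ∏ Y ∈ R.Ys a, Real.exp (-(c 1) - κ₁ * (tsys 4 Nc).dj Y))
    {LF DomY Cube Var Sv : Type*} [Fintype LF] [Fintype DomY] [Fintype Cube] [DecidableEq LF] [DecidableEq DomY]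
    [DecidableEq Cube] {adjC : Cube → Cube → Prop} [DecidableRel adjC]
    (hrefl : ∀ a, adjC a a) (hsymm : ∀ a b, adjC a b → adjC b a)
    {locX : LF → Finset Cube} {locY : DomY → Finset Cube} {site : Var → Cube} (Yfix : R.Adm → Finset Cube)
    (houtX : ∀ a j, (locX j \ Yfix a).Nonempty) (houtY : ∀ a Y, (locY Y \ Yfix a).Nonempty)
    (Op : R.Adm → Finset LF → ((Var → Sv) → ℂ) →+ ((Var → Sv) → ℂ))
    (hOps : ∀ a, LocalOps adjC locX (Yfix a) site (Op a))
    (hOpReal : ∀ a (S : Finset LF) (f : (Var → Sv) → ℂ), (∀ ψ, (f ψ).im = 0) → ∀ φ, (Op a S f φ).im = 0)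
    (Vt : R.Adm → DomY → (Var → Sv) → ℂ) (hV : ∀ a Y, DepOn (Yfix a) site (Vt a Y) (locY Y))
    (hVreal : ∀ a Y ψ, (Vt a Y ψ).im = 0) (cfg : GaugeField (F.P P.K) k (SU N) → (Var → Sv))
    {nbr : Cube → Finset Cube} (hnbr : ∀ a b, adjC a b → a ∈ nbr b) {νn : ℝ} (hν : ∀ b, ((nbr b).card : ℝ) ≤ νn)
    {d : R.Adm → Finset Cube → ℝ} {c₁ Rr κ₀ K₀ cv τ : ℝ} (hd : ∀ a X, 0 ≤ d a X) (hc₁ : 0 ≤ c₁) (hK₀ : 0 ≤ K₀)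
    (hτ : 0 ≤ τ)
    (h197 : ∀ a V X, ‖F191 adjC locX locY (Yfix a) (mayerTerm (Op a) (Vt a) (cfg V)) X‖ ≤ c₁ * Real.exp (-(Rr * d a X)))
    (h126 : ∀ a, Ineq126 (polys190 adjC locX locY (Yfix a)) (fun X => X \ Yfix a) (d a) κ₀ K₀)
    (hvol : ∀ a, VolBound (polys190 adjC locX locY (Yfix a)) (fun X => X \ Yfix a) (d a) cv)
    (hrate : κ₀ + τ * cv ≤ Rr) (hsmall : c₁ * Real.exp (τ * cv) * K₀ * νn ≤ τ)
    (hjunction : ∀ a V, R.curly a V = (bracket (Op a) (Vt a) (cfg V)).re)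
    {πc : ℝ} (hQ : (Fintype.card Cube : ℝ) ≤ πc * (Fintype.card (Site (F.P P.K) k) : ℝ))
    (logT : GaugeField (F.P P.K) k (SU N) → ℝ) {CA cΓ cL cL' : ℝ} {Γ : ℕ → ℝ} (hCA : 0 ≤ CA)
    (hΓ : ∑ n ∈ Finset.Icc 1 k, Γ n ≤ cΓ * (Fintype.card (Site (F.P P.K) k) : ℝ))
    (h249 : ∀ V, Ineq249 (R.A' V) (1 / (genSeq M.βfun P.g0 k) ^ 2 * M.wilsonBG P k V) (logT V) CA Γ k)
    (hlog : ∀ V, -(cL * (Fintype.card (Site (F.P P.K) k) : ℝ)) ≤ logT V)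
    (hlog' : ∀ V, logT V ≤ cL' * (Fintype.card (Site (F.P P.K) k) : ℝ))
    (hA0 : ∀ V, 0 ≤ M.wilsonBG P k V) :
    ∀ V : GaugeField (F.P P.K) k (SU N),
      B16.UVIneq (M.construction ρ P) k V (CA * cΓ + cL + πc * (c₁ * Real.exp (τ * cv) * K₀))
        (CA * cΓ + cL' + πc * (c₁ * Real.exp (τ * cv) * K₀) +
          M₁⁻¹ ^ 4 * B12TreeDecay.K₀ (4 * 2 ^ 4) (2 * 4) * ∑ i, Real.exp (-(c i))) :=
  uvIneq_of_repr172_torus_of_ineq249_of_gas (M.construction ρ P) k Nc R hM hnum hκ c hH hχ01 h0χ hZ hY hrefl hsymm Yfix houtX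
    houtY Op hOps hOpReal Vt hV hVreal cfg hnbr hν hd hc₁ hK₀ hτ h197 h126 hvol hrate hsmall hjunction hQ logT hCA hΓ h249 hlog
    hlog' hA0

end Construction

/-! ## §1. The chain's END theorem AT THE OBJECTS OF RECORD (Stage 9) -/

section AtRecord

variable (θ : Stage9Params F N) (h : θ.Provisos) (P : B12.RunParams) (k : ℕ)

/-- **(0.1) ∕ (2.50) AT THE CONSTRUCTION OF RECORD, unfolded** (`rfl` through `datumOfRecord₉_C` and `RGMachineCore.construction`): at `D := (datumOfRecord₉ F N θ h).C P`,
`B16.UVIneq D k V Em Ep` IS «`χ_k(V)·exp[−(1∕g_k²)A^η_k(V) − Em·|T₁^{(k)}|] ≤ ρ_k(V)` ∧ `ρ_k(V) ≤ exp(Ep·|T₁^{(k)}|)`» with `χ_k = chiOfRecord F N θ.ν (gOfRecord₉ F N θ P) P.K k`,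
`A^η_k = wilsonBGOfRecord F N θ.εbg P k`, `g_k = gOfRecord₉ F N θ P k`, `ρ_k = densOfRecord₉ F N θ P k` (EXPLICIT, `= eval rep_k`), `|T₁^{(k)}| = |Site (F.P P.K) k|`.
[cite: Balaban1989LargeFieldII, (0.1) pp.355–356; Balaban1988Convergent, (2.17)–(2.18) p.257, (2.50) p.264 (bookkeeping)] -/
theorem uvIneq_at_record₉_iff (V : GaugeField (F.P P.K) k (SU N)) (Em Ep : ℝ) :
    B16.UVIneq ((datumOfRecord₉ F N θ h).C P) k V Em Ep ↔
      chiOfRecord F N θ.ν (gOfRecord₉ F N θ P) P.K k V *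
            Real.exp (-(1 / (gOfRecord₉ F N θ P k) ^ 2 * wilsonBGOfRecord F N θ.εbg P k V) - Em * (Fintype.card (Site (F.P P.K) k) : ℝ)) ≤
          densOfRecord₉ F N θ P k V ∧
        densOfRecord₉ F N θ P k V ≤ Real.exp (Ep * (Fintype.card (Site (F.P P.K) k) : ℝ)) :=
  uvIneq_at_construction_iff F N (coreOfRecord₉ F N θ) (densOfRecord₉ F N θ) P k V Em Ep

/-- **THE COR.-3 CHAIN'S END THEOREM AT THE OBJECTS OF RECORD** — the ₉ junction of `B16Cor3CurlyGas.uvIneq_of_repr172_torus_of_ineq249_of_gas` to `densOfRecord₉`: one run `P`, one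
level `k`, at `D := (datumOfRecord₉ F N θ h).C P`.  BINDERS = the chain's, READ AT THE RECORD: a (1.72) representation `R` of `ρ_k` OF RECORD on the torus cube catalogue
(`hH : R.Holds (densOfRecord₉ F N θ P k)` — [Balaban1989LargeFieldII] Thm 1's own output «𝐑ρ_k can be written in the form …», p. 390), its χ-dictionary against `chiOfRecord`
(`hχ01`, `h0χ`), the site count `|T₁^{(k)}| = (M₁·Nc)⁴` (`hnum`), the factor leaves (1.79)∕(1.89) per component (`hZ`, `hY`), the (1.90) gas of every admissible term at the
configurations `cfg : GaugeField (F.P P.K) k (SU N) → (Var → Sv)` (`hrefl … hjunction`, verbatim), the cube count (`hQ`), and (2.49) [III] for `R.A'` against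
`(1∕g_k²)·A^η_k` of record with the volume majorant and the log-term bounds (`hCA`, `hΓ`, `h249`, `hlog`, `hlog'` — [Balaban1988Convergent] Thm 2's output: the N11 → N13 Cor.-3 edge AT
THE RECORD).  The chain's sign binder `hA0 : 0 ≤ A^η_k(V)` is DISCHARGED: `Node00.wilsonBGOfRecord_nonneg` (a theorem of record).  Conclusion: (0.1) at every configuration with
`E₋ = CA·c_Γ + c_L + πc·b`, `E₊ = CA·c_Γ + c_L′ + πc·b + M₁⁻⁴·K₀(64,8)·Σ_i e^{−c_i}`, `b = c₁e^{τc_v}K₀`.  CONDITIONAL on every input; nothing of Bałaban's asserted; count-neutral.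
[cite: Balaban1989LargeFieldII, (0.1) p.356, (1.72) p.379, p.387 after (1.89), (1.98) p.390; Balaban1988Convergent, (2.49)–(2.50) p.264] -/
theorem uvIneq_at_record₉_of_gas (Nc : ℕ) [NeZero Nc] (R : Repr172 (GaugeField (F.P P.K) k (SU N)) (tsys 4 Nc).Dom)
    {M₁ : ℝ} (hM : M₁ ≠ 0) (hnum : (Fintype.card (Site (F.P P.K) k) : ℝ) = (M₁ * Nc) ^ 4)
    {κ₁ : ℝ} (hκ : B12TreeDecay.kappa₀ (4 * 2 ^ 4) (2 * 4) ≤ κ₁) (c : Fin 2 → ℝ)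
    (hH : R.Holds (densOfRecord₉ F N θ P k))
    (hχ01 : ∀ a V, 0 ≤ R.χ a V ∧ R.χ a V ≤ 1)
    (h0χ : ∀ V, R.χ R.allSmall V = chiOfRecord F N θ.ν (gOfRecord₉ F N θ P) P.K k V)
    (hZ : ∀ a V, (R.TZ a).T 1 V ≤ ∏ X ∈ R.Zc a, Real.exp (-(c 0) - κ₁ * (tsys 4 Nc).dj X))
    (hY : ∀ a V, (R.TYs a).T 1 V ≤ ∏ Y ∈ R.Ys a, Real.exp (-(c 1) - κ₁ * (tsys 4 Nc).dj Y))
    {LF DomY Cube Var Sv : Type*} [Fintype LF] [Fintype DomY] [Fintype Cube] [DecidableEq LF] [DecidableEq DomY]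
    [DecidableEq Cube] {adjC : Cube → Cube → Prop} [DecidableRel adjC]
    (hrefl : ∀ a, adjC a a) (hsymm : ∀ a b, adjC a b → adjC b a)
    {locX : LF → Finset Cube} {locY : DomY → Finset Cube} {site : Var → Cube} (Yfix : R.Adm → Finset Cube)
    (houtX : ∀ a j, (locX j \ Yfix a).Nonempty) (houtY : ∀ a Y, (locY Y \ Yfix a).Nonempty)
    (Op : R.Adm → Finset LF → ((Var → Sv) → ℂ) →+ ((Var → Sv) → ℂ))
    (hOps : ∀ a, LocalOps adjC locX (Yfix a) site (Op a))
    (hOpReal : ∀ a (S : Finset LF) (f : (Var → Sv) → ℂ), (∀ ψ, (f ψ).im = 0) → ∀ φ, (Op a S f φ).im = 0)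
    (Vt : R.Adm → DomY → (Var → Sv) → ℂ) (hV : ∀ a Y, DepOn (Yfix a) site (Vt a Y) (locY Y))
    (hVreal : ∀ a Y ψ, (Vt a Y ψ).im = 0) (cfg : GaugeField (F.P P.K) k (SU N) → (Var → Sv))
    {nbr : Cube → Finset Cube} (hnbr : ∀ a b, adjC a b → a ∈ nbr b) {νn : ℝ} (hν : ∀ b, ((nbr b).card : ℝ) ≤ νn)
    {d : R.Adm → Finset Cube → ℝ} {c₁ Rr κ₀ K₀ cv τ : ℝ} (hd : ∀ a X, 0 ≤ d a X) (hc₁ : 0 ≤ c₁) (hK₀ : 0 ≤ K₀)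
    (hτ : 0 ≤ τ)
    (h197 : ∀ a V X, ‖F191 adjC locX locY (Yfix a) (mayerTerm (Op a) (Vt a) (cfg V)) X‖ ≤ c₁ * Real.exp (-(Rr * d a X)))
    (h126 : ∀ a, Ineq126 (polys190 adjC locX locY (Yfix a)) (fun X => X \ Yfix a) (d a) κ₀ K₀)
    (hvol : ∀ a, VolBound (polys190 adjC locX locY (Yfix a)) (fun X => X \ Yfix a) (d a) cv)
    (hrate : κ₀ + τ * cv ≤ Rr) (hsmall : c₁ * Real.exp (τ * cv) * K₀ * νn ≤ τ)
    (hjunction : ∀ a V, R.curly a V = (bracket (Op a) (Vt a) (cfg V)).re)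
    {πc : ℝ} (hQ : (Fintype.card Cube : ℝ) ≤ πc * (Fintype.card (Site (F.P P.K) k) : ℝ))
    (logT : GaugeField (F.P P.K) k (SU N) → ℝ) {CA cΓ cL cL' : ℝ} {Γ : ℕ → ℝ} (hCA : 0 ≤ CA)
    (hΓ : ∑ n ∈ Finset.Icc 1 k, Γ n ≤ cΓ * (Fintype.card (Site (F.P P.K) k) : ℝ))
    (h249 : ∀ V, Ineq249 (R.A' V) (1 / (gOfRecord₉ F N θ P k) ^ 2 * wilsonBGOfRecord F N θ.εbg P k V) (logT V) CA Γ k)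
    (hlog : ∀ V, -(cL * (Fintype.card (Site (F.P P.K) k) : ℝ)) ≤ logT V)
    (hlog' : ∀ V, logT V ≤ cL' * (Fintype.card (Site (F.P P.K) k) : ℝ)) :
    ∀ V : GaugeField (F.P P.K) k (SU N),
      B16.UVIneq ((datumOfRecord₉ F N θ h).C P) k V (CA * cΓ + cL + πc * (c₁ * Real.exp (τ * cv) * K₀))
        (CA * cΓ + cL' + πc * (c₁ * Real.exp (τ * cv) * K₀) +
          M₁⁻¹ ^ 4 * B12TreeDecay.K₀ (4 * 2 ^ 4) (2 * 4) * ∑ i, Real.exp (-(c i))) :=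
  uvIneq_at_construction_of_gas F N (coreOfRecord₉ F N θ) (densOfRecord₉ F N θ) P k Nc R hM hnum hκ c hH hχ01 h0χ hZ hY
    hrefl hsymm Yfix houtX houtY Op hOps hOpReal Vt hV hVreal cfg hnbr hν hd hc₁ hK₀ hτ h197 h126 hvol hrate hsmall hjunction hQ
    logT hCA hΓ h249 hlog hlog' (fun V => wilsonBGOfRecord_nonneg F N θ.εbg P k V)

end AtRecord

/-! ## §2. N13 at a Stage-9 world ∕ at the Stage-9 record from (R₉) + the chain's output IN ITS OWN LETTERS, dominated by the world's dependence functions -/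

section Knit

variable (θ : Stage9Params F N) (w : WorldP) (P : B12.RunParams) (h : θ.Provisos)

/-- **N13 AT A STAGE-9 WORLD FROM (R₉) AND THE COR.-3 CHAIN'S OUTPUT IN ITS OWN LETTERS** ([Balaban1989LargeFieldII] Thm 1 p. 355 + (0.1), Cor. 3 pp. 387 ∕ 391, AT NODE 00's
Stage-9 objects): for `w.C = (datumOfRecord₉ F N θ h).C`, `w.up P = upOfRecord₅C F N (θ.toStage5 F N) P`, from — (R₉) `hR9` (law transport by 𝐑 along the tower of record; IS the
leaf, module 14 §1); level-indexed constant families in the chain's letters `CA, cΓ, cL, cL′, πc, c₁, τ, cv, K₀, M₁ : ℕ → ℝ`, `c : ℕ → Fin 2 → ℝ` (the (2.49) constant and log-term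
slopes, the cube-count ratio, the (1.97)∕Kotecký–Preiss constants, the cube side, the (1.79)∕(1.89) exponents); `huv`: below the threshold `γ₁ ≥ w.γ`, every §2-format level `k ≤ K`
satisfies (0.1) at every configuration with `E₋(k) = CA·cΓ + cL + πc·(c₁e^{τcv}K₀)`, `E₊(k) = E₋-shape with cL′ + M₁⁻⁴·K₀(64,8)·Σ_i e^{−c_i}` — EXACTLY the conclusion of §1
`uvIneq_at_record₉_of_gas` at level `k` (so `huv` is supplied level by level from a (1.72) representation of `ρ_k` of record + the chain's leaves); `hdom`: DOMINATION
`E₋(k) ≤ w.em (g_k)`, `E₊(k) ≤ w.ep (g_k)` by the world's dependence functions of the coupling (p. 356 «E₋, E₊ independent of k, T_η, U_k» in the tree's reading: functions of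
`g_k` alone).  = module 14 §3 `b16_main_at_record₉_dominated` with `Em := E₋(k)`, `Ep := E₊(k)`.  HYPOTHESES displayed; count-neutral; nothing of Bałaban's asserted.
[cite: Balaban1989LargeFieldII, Thm 1 p.355, (0.1) pp.355–356, p.387, p.391; Balaban1988Convergent, p.244, (2.49)–(2.50) p.264] -/
theorem b16_main_at_record₉_of_chainLetters (hC : w.C = (datumOfRecord₉ F N θ h).C) (hup : w.up P = upOfRecord₅C F N (θ.toStage5 F N) P)
    (hR9 : ∀ k, k < P.K → TLaw₉ F N θ P k → SLaw₉ F N θ P (k + 1)) {γ₁ : ℝ} (hγ : w.γ ≤ γ₁)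
    (CA cΓ cL cL' πc c₁ τ cv K₀ M₁ : ℕ → ℝ) (c : ℕ → Fin 2 → ℝ)
    (huv : (genFlow (betaOfRecord₉ F N θ) P.g0).InInterval γ₁ P.K → ∀ k, k ≤ P.K → SLaw₉ F N θ P k →
      ∀ V : GaugeField (F.P P.K) k (SU N),
        B16.UVIneq ((datumOfRecord₉ F N θ h).C P) k V (CA k * cΓ k + cL k + πc k * (c₁ k * Real.exp (τ k * cv k) * K₀ k))
          (CA k * cΓ k + cL' k + πc k * (c₁ k * Real.exp (τ k * cv k) * K₀ k) +
            (M₁ k)⁻¹ ^ 4 * B12TreeDecay.K₀ (4 * 2 ^ 4) (2 * 4) * ∑ i, Real.exp (-(c k i))))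
    (hdom : ∀ k, k ≤ P.K →
      CA k * cΓ k + cL k + πc k * (c₁ k * Real.exp (τ k * cv k) * K₀ k) ≤ w.em (gOfRecord₉ F N θ P k) ∧
      CA k * cΓ k + cL' k + πc k * (c₁ k * Real.exp (τ k * cv k) * K₀ k) +
          (M₁ k)⁻¹ ^ 4 * B12TreeDecay.K₀ (4 * 2 ^ 4) (2 * 4) * ∑ i, Real.exp (-(c k i)) ≤ w.ep (gOfRecord₉ F N θ P k)) :
    Dag.B16_main (leavesP w P) :=
  b16_main_at_record₉_dominated F N θ w P h hC hup hR9 hγ fun hsc k hk hS =>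
    ⟨_, _, (hdom k hk).1, (hdom k hk).2, huv hsc k hk hS⟩

variable {F N} {D : FiniteEpsData F (SU N)} {w}

/-- **N13 AT NODE 00's STAGE-9 RECORD `IsRecordOfRecord₉C` FROM (R₉) AND THE CHAIN'S OUTPUT IN ITS OWN LETTERS** — the `S_N13 (₉C)`-currency form: for the record's admissible `θ`
with provisos `h` (`D = datumOfRecord₉ F N θ h`, runs bound over `θ.toStage5 F N`), per run `P`: (R₉), and constant families (indexed by `θ, P, k`) in the chain's letters with (0.1)
at every §2-format level below `w.γ` in those letters (`huv`, = §1 level by level) and domination by `w.em ∕ w.ep` (`hdom`).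
[cite: Balaban1989LargeFieldII, Thm 1 p.355, (0.1) pp.355–356, p.387, p.391; Balaban1988Convergent, p.244, (2.49)–(2.50) p.264] -/
theorem b16_main_of_isRecordOfRecord₉C_of_chainLetters (hrec : IsRecordOfRecord₉C F N D w)
    (CA cΓ cL cL' πc c₁ τ cv K₀ M₁ : Stage9Params F N → B12.RunParams → ℕ → ℝ) (c : Stage9Params F N → B12.RunParams → ℕ → Fin 2 → ℝ)
    (slots : ∀ (θ : Stage9Params F N) (h : θ.Provisos), θ.Admissible → D = datumOfRecord₉ F N θ h →
      (∀ P, w.up P = upOfRecord₅C F N (θ.toStage5 F N) P) → ∀ P : B12.RunParams,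
        (∀ k, k < P.K → TLaw₉ F N θ P k → SLaw₉ F N θ P (k + 1)) ∧
        ((genFlow (betaOfRecord₉ F N θ) P.g0).InInterval w.γ P.K → ∀ k, k ≤ P.K → SLaw₉ F N θ P k →
          ∀ V : GaugeField (F.P P.K) k (SU N),
            B16.UVIneq ((datumOfRecord₉ F N θ h).C P) k V
              (CA θ P k * cΓ θ P k + cL θ P k + πc θ P k * (c₁ θ P k * Real.exp (τ θ P k * cv θ P k) * K₀ θ P k))
              (CA θ P k * cΓ θ P k + cL' θ P k + πc θ P k * (c₁ θ P k * Real.exp (τ θ P k * cv θ P k) * K₀ θ P k) +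
                (M₁ θ P k)⁻¹ ^ 4 * B12TreeDecay.K₀ (4 * 2 ^ 4) (2 * 4) * ∑ i, Real.exp (-(c θ P k i)))) ∧
        (∀ k, k ≤ P.K →
          CA θ P k * cΓ θ P k + cL θ P k + πc θ P k * (c₁ θ P k * Real.exp (τ θ P k * cv θ P k) * K₀ θ P k) ≤
              w.em (gOfRecord₉ F N θ P k) ∧
          CA θ P k * cΓ θ P k + cL' θ P k + πc θ P k * (c₁ θ P k * Real.exp (τ θ P k * cv θ P k) * K₀ θ P k) +
              (M₁ θ P k)⁻¹ ^ 4 * B12TreeDecay.K₀ (4 * 2 ^ 4) (2 * 4) * ∑ i, Real.exp (-(c θ P k i)) ≤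
            w.ep (gOfRecord₉ F N θ P k))) :
    ∀ P : B12.RunParams, Dag.B16_main (leavesP w P) := by
  intro P
  obtain ⟨θ, h, hθ, hD, hC, -, -, hup⟩ := hrec
  obtain ⟨hR9, huv, hdom⟩ := slots θ h hθ hD hup P
  exact b16_main_at_record₉_of_chainLetters F N θ w P h (by rw [hC, hD]) (hup P) hR9 le_rfl (CA θ P) (cΓ θ P) (cL θ P)
    (cL' θ P) (πc θ P) (c₁ θ P) (τ θ P) (cv θ P) (K₀ θ P) (M₁ θ P) (c θ P) huv hdom

end Knit

end Literature.MathematicalPhysics.QuantumFieldTheory.Balaban1983to89.B16NodeKnitRecord9Cor3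

end
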